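import Summits.BirchSwinnertonDyer.BirchSwinnertonDyer.Theorems.PrintCf2RamifiedOffTYZGaloisMotion
import HarnessLib

/-!
# Route `PrintCf2`, crux stmt-BirchSwinnertonDyer-20509 `RamifiedOffTYZOfFacts` — THE TWO HALVES OF C⁺ IN INDEX FORM:
# «`2 ∣ 𝓛(n)` ⟺ `P(n) ∈ ℤ·Q₁ + tors`» and «`4 ∣ 𝓛(n)` ⟺ `P(n) ∈ 2ℤ·Q₁ + tors`»; on the visible part the lower half holds
# (cell `bsd-print-cf2`, LEAD of 20509 g11, line `offtyz-v7`, lineage cycle 12; fact-free, Theses-free, no `def`)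

HONEST FRAMING (crux 20509 = `𝔅_ram → WAllCornerFTwoRamifiedOffTYZProved`, DECIDING, OPEN AS A CLASS): bookkeeping on
Tian–Yuan–Zhang's Theorem 3.5 main clause taken as a HYPOTHESIS on the displayed data (`D.thm35Main`, `D.scriptLSpec` on
`D : GenusPointData n`, arXiv:1411.4728 §3 AS PRINTED), GZK by name, the W2 descent kernel and g3's `ρ`-free main clause
`2·P(n) ≡ ±𝓛(n)·Q₁` (`…LevelTwoHalfGenerator`, p665240).  Nothing is asserted; C⁺ = `stub_offTYZ_levelTwoScriptLExact` (= item
stmt-BirchSwinnertonDyer-23431) stays open.  Kernel end of the LEAD note `Cruxes/RamifiedOffTYZOfFacts/Lines/offtyz_v7_Certificates.md`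
(cycle 12): the Kolyvagin reading `v₂(𝓛(n)) = M₀`, the position of the genus point on the half-line `ℤ·Q₁ ⊂ A(ℍ′_n)/tors`.

* §1 (abstract, any additive commutative group; `2·P − (u·L)·Q` torsion, `u = ±1`, `Q` non-torsion):
  `two_pow_succ_dvd_iff_exists_zsmul` — **`2^{k+1} ∣ L ⟺ P − (2^k·m)·Q` is torsion for some `m`**; in particular
  `two_dvd_iff_exists_zsmul` (LOWER HALF ⟺ `P ∈ ℤQ + tors`) and `four_dvd_iff_exists_two_mul_zsmul` (`4 ∣ L ⟺ P ∈ 2ℤQ + tors`);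
  `isOfFinAddOrder_map_sub_of_two_smul` — an additive endomorphism `f` with `2·(fQ − Q) = 0` moves `P` by a TORSION element;
  `not_exists_two_mul_zsmul_of_map_sub_not_mem` — if moreover `f` moves every torsion element inside a set `S` and
  `fP − P ∉ S`, then `P ∉ 2ℤQ + tors` (the abstract UPPER-HALF DOOR, used by the sequel `…LevelTwoGenusQuotient`).
* §2 (`E_n`, square-free `n ≡ 5, 6, 7 (mod 8)`, `ord_{s=1} L(E_n,s) = 1`, GZK, `D` with Thm 3.5 main clause + integrality; `R` a
  generator of `E_n(ℚ)` mod torsion, `Q₁` any half of its twist):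
  `two_dvd_scriptL_iff_genusPoint_mem_line` — **LOWER HALF of C⁺ ⟺ `P(n) − m·Q₁ ∈ A(ℍ′_n)_tor` for some `m ∈ ℤ`**;
  `four_dvd_scriptL_iff_genusPoint_mem_twice_line` — **`4 ∣ 𝓛(n)` (the B-locus digit) ⟺ `P(n) − 2m·Q₁ ∈ tors` for some `m`**;
  `levelTwo_iff_mem_line_and_not_mem_twice_line` — C⁺ at `n` ⟺ both; `two_dvd_scriptL_of_half_not_twoDivisible` — on the VISIBLE
  part (`Q₁ ∉ 2A(ℍ′_n) + tors`) the LOWER half holds (contrapositive of g3's `half_twoDivisible_of_odd_scriptL`).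

What this buys the line (LEAD census, crux 20509): C⁺ = «`M₀(n) = 1`» where `2^{M₀}` is the index of `P(n)` relative to `Q₁` on the
common line in `A(ℍ′_n)/tors` — the lower half «on the line», the upper half «not on the doubled line»; on the visible part only the
upper half is open.  Beyond-print theorem: NO (bookkeeping of a printed clause); C⁺ stays open; BSD is not proved by any of this;
no class is closed by this file.

References: [cite: TianYuanZhang2017, Thm. 3.5 (p0011 L94–L100), §3.1 (p0011 L27–L36)]; [cite: SilvermanAEC2009, X.4.9];
[cite: Darmon2004, Thm. 3.22] (GZK); [cite: GrossLMS1991, §3] (Kolyvagin's index `M₀`); tree: g3 `…LevelTwoHalfGenerator` (p665240),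
g4 `…GaloisMotion` (p671505), g0 `…LevelTwoGenusPoint`.
-/

noncomputable section

open scoped Classical

open WeierstrassCurve WeierstrassCurve.Affine Literature.NumberTheory.EllipticCurves
  Literature.NumberTheory.EllipticCurves.Rank1Residual Summit.BirchSwinnertonDyer.Rank1Residual
  Literature.NumberTheory.EllipticCurves.TianYuanZhang2017
  Literature.NumberTheory.EllipticCurves.TianYuanZhang2017.W2
  Summit.BirchSwinnertonDyer.PrintCf2.LevelTwoHalfGenerator
  Summit.BirchSwinnertonDyer.PrintCf2.GaloisMotion
  Summit.BirchSwinnertonDyer.Rank1Residual.P2.ThetaDescent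

set_option autoImplicit false

namespace Summit.BirchSwinnertonDyer.PrintCf2.LevelTwoHalves

/-! ## §1 Abstract: the index form of the two halves, and the abstract doors -/

section Abstract

variable {G : Type*} [AddCommGroup G]

/-- **`2^{k+1} ∣ L ⟺ P ∈ 2^k·ℤ·Q + tors`**, given the torsion relation `2·P − (u·L)·Q ∈ tors` with `u = ±1` and `Q` non-torsion
(Kolyvagin's index reading of Thm 3.5: `v₂(L)` is the position of `P` on the half-line `ℤ·Q`). [folklore] -/
theorem two_pow_succ_dvd_iff_exists_zsmul {P Q : G} {L u : ℤ} (hu : u = 1 ∨ u = -1) (hQ : ¬ IsOfFinAddOrder Q)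
    (hrel : IsOfFinAddOrder ((2 : ℤ) • P - (u * L) • Q)) (k : ℕ) :
    (2 : ℤ) ^ (k + 1) ∣ L ↔ ∃ m : ℤ, IsOfFinAddOrder (P - ((2 : ℤ) ^ k * m) • Q) := by
  have hu2 : u * u = 1 := by rcases hu with rfl | rfl <;> norm_num
  constructor
  · rintro ⟨c, hc⟩
    refine ⟨u * c, ?_⟩
    have e : (2 : ℤ) • P - (u * L) • Q = (2 : ℤ) • (P - ((2 : ℤ) ^ k * (u * c)) • Q) := by
      rw [hc, pow_succ]; module
    rw [e] at hrel
    exact LevelTwo.isOfFinAddOrder_of_zsmul two_ne_zero hrel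
  · rintro ⟨m, hm⟩
    -- `(u L − 2^{k+1} m)·Q` is torsion, hence the coefficient vanishes
    have h0 : IsOfFinAddOrder ((u * L - (2 : ℤ) ^ (k + 1) * m) • Q) := by
      have e : (u * L - (2 : ℤ) ^ (k + 1) * m) • Q =
          (2 : ℤ) • (P - ((2 : ℤ) ^ k * m) • Q) + -((2 : ℤ) • P - (u * L) • Q) := by
        rw [pow_succ]; module
      rw [e]
      exact hm.zsmul.add hrel.neg
    have hz := LevelTwo.eq_zero_of_isOfFinAddOrder_zsmul hQ h0
    refine ⟨u * m, ?_⟩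
    have : L = u * (u * L) := by rw [← mul_assoc, hu2, one_mul]
    rw [this, show u * L = (2 : ℤ) ^ (k + 1) * m by linarith]
    ring

/-- **LOWER HALF ⟺ ON THE LINE**: `2 ∣ L ⟺ P − m·Q ∈ tors` for some integer `m`. [folklore] -/
theorem two_dvd_iff_exists_zsmul {P Q : G} {L u : ℤ} (hu : u = 1 ∨ u = -1) (hQ : ¬ IsOfFinAddOrder Q)
    (hrel : IsOfFinAddOrder ((2 : ℤ) • P - (u * L) • Q)) :
    (2 : ℤ) ∣ L ↔ ∃ m : ℤ, IsOfFinAddOrder (P - m • Q) := by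
  have h := two_pow_succ_dvd_iff_exists_zsmul hu hQ hrel 0
  simp only [zero_add, pow_one, pow_zero, one_mul] at h
  exact h

/-- **`4 ∣ L` ⟺ ON THE DOUBLED LINE**: `4 ∣ L ⟺ P − (2m)·Q ∈ tors` for some integer `m`. [folklore] -/
theorem four_dvd_iff_exists_two_mul_zsmul {P Q : G} {L u : ℤ} (hu : u = 1 ∨ u = -1) (hQ : ¬ IsOfFinAddOrder Q)
    (hrel : IsOfFinAddOrder ((2 : ℤ) • P - (u * L) • Q)) :
    (4 : ℤ) ∣ L ↔ ∃ m : ℤ, IsOfFinAddOrder (P - (2 * m) • Q) := by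
  have h := two_pow_succ_dvd_iff_exists_zsmul hu hQ hrel 1
  norm_num at h
  exact h

/-- **C⁺'s conclusion ⟺ on the line, not on the doubled line.** [folklore] -/
theorem two_dvd_not_four_dvd_iff_line {P Q : G} {L u : ℤ} (hu : u = 1 ∨ u = -1) (hQ : ¬ IsOfFinAddOrder Q)
    (hrel : IsOfFinAddOrder ((2 : ℤ) • P - (u * L) • Q)) :
    ((2 : ℤ) ∣ L ∧ ¬ (4 : ℤ) ∣ L) ↔
      (∃ m : ℤ, IsOfFinAddOrder (P - m • Q)) ∧ ¬ ∃ m : ℤ, IsOfFinAddOrder (P - (2 * m) • Q) := by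
  rw [two_dvd_iff_exists_zsmul hu hQ hrel, four_dvd_iff_exists_two_mul_zsmul hu hQ hrel]

/-- **An endomorphism fixing `2·Q` moves `P` inside the torsion** (given `2·P − c·Q ∈ tors`): apply `f`, subtract.
[folklore] -/
theorem isOfFinAddOrder_map_sub_of_two_smul {P Q : G} {c : ℤ} (f : G →+ G)
    (hfQ : (2 : ℤ) • (f Q - Q) = 0) (hrel : IsOfFinAddOrder ((2 : ℤ) • P - c • Q)) :
    IsOfFinAddOrder (f P - P) := by
  have h1 : IsOfFinAddOrder ((2 : ℤ) • f P - c • f Q) := by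
    have := f.isOfFinAddOrder hrel
    rwa [map_sub, map_zsmul, map_zsmul] at this
  -- `c • (fQ − Q)` is torsion (it is killed by `2`)
  have h2 : IsOfFinAddOrder (c • (f Q - Q)) := by
    refine IsOfFinAddOrder.zsmul ?_
    exact isOfFinAddOrder_iff_zsmul_eq_zero.mpr ⟨2, two_ne_zero, hfQ⟩
  have h3 : IsOfFinAddOrder ((2 : ℤ) • (f P - P)) := by
    have e : (2 : ℤ) • (f P - P) = ((2 : ℤ) • f P - c • f Q) + -((2 : ℤ) • P - c • Q) + c • (f Q - Q) := by module
    rw [e]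
    exact (h1.add hrel.neg).add h2
  exact LevelTwo.isOfFinAddOrder_of_zsmul two_ne_zero h3

/-- **THE ABSTRACT UPPER-HALF DOOR.** If `f` fixes `2·Q`, moves every torsion element by an element of `S`, and moves `P` by
an element OUTSIDE `S`, then `P ∉ 2ℤ·Q + tors`. (`P = 2mQ + t` would give `fP − P = m·2(fQ − Q) + (ft − t) = ft − t ∈ S`.)
[folklore] -/
theorem not_exists_two_mul_zsmul_of_map_sub_not_mem {P Q : G} (f : G →+ G) (S : Set G)
    (hfQ : (2 : ℤ) • (f Q - Q) = 0) (hS : ∀ t : G, IsOfFinAddOrder t → f t - t ∈ S) (hP : f P - P ∉ S) :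
    ¬ ∃ m : ℤ, IsOfFinAddOrder (P - (2 * m) • Q) := by
  rintro ⟨m, hm⟩
  apply hP
  have e : f P - P = m • ((2 : ℤ) • (f Q - Q)) + (f (P - (2 * m) • Q) - (P - (2 * m) • Q)) := by
    rw [map_sub, map_zsmul]; module
  rw [e, hfQ, smul_zero, zero_add]
  exact hS _ hm

end Abstract

/-! ## §2 The two halves of C⁺ at `n` in `E_n(ℚ)`-currency -/

section EnSide

variable {n : ℕ}

/-- **LOWER HALF ⟺ THE GENUS POINT LIES ON THE LINE `ℤ·Q₁` modulo torsion.** Square-free `n ≡ 5, 6, 7 (mod 8)` with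
`ord_{s=1} L(E_n, s) = 1`; GZK; `D` with Thm 3.5's displayed main clause and integrality; `R` a generator of `E_n(ℚ)` mod
torsion; `Q₁ ∈ A(ℍ′_n)` any point with `φ_H(Q₁) = ι Θ_E(R)`.  Then `2 ∣ L` for every sign choice `L` of `𝓛(n)` **iff
`P(n) − m·Q₁ ∈ A(ℍ′_n)_tor` for some `m ∈ ℤ`.** [cite: TianYuanZhang2017, Thm. 3.5 (p0011 L94–L100)] [cite: Darmon2004, Thm. 3.22] -/
theorem two_dvd_scriptL_iff_genusPoint_mem_line
    (hGZK : rank_eq_analyticRank_of_analyticRank_le_one) (hsq : Squarefree n)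
    (h8 : n % 8 = 5 ∨ n % 8 = 6 ∨ n % 8 = 7) (hr : (congruentNumberCurve n).analyticRank = 1)
    (D : GenusPointData n) (h35 : D.thm35Main) (hLs : D.scriptLSpec)
    {R : (congruentNumberCurve n).toAffine.Point} (hR : ∀ x, ∃ k : ℤ, IsOfFinAddOrder (x - k • R))
    {Q₁ : APoint D.H} (hQ₁ : φH D Q₁ = Point.map (W' := curveA.twoIsogenyCodomain)
      (D.embK n (Nat.mem_divisors_self n hsq.ne_zero)) (ΘE hsq.ne_zero R)) :
    (∀ L : ℤ, IsScriptL n L → (2 : ℤ) ∣ L) ↔ ∃ m : ℤ, IsOfFinAddOrder (D.P n - m • Q₁) := by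
  haveI := isElliptic_congruentNumberCurve hsq.ne_zero
  have hn : n ∈ n.divisors := Nat.mem_divisors_self n hsq.ne_zero
  have hn1 : 1 < n := by rcases h8 with h | h | h <;> omega
  have hLD : IsScriptL n (D.scriptL n) := hLs n hn hn1
  have hL0 : D.scriptL n ≠ 0 := (P2.bsdp_two_congruentNumberCurve_iff_of_isScriptL hGZK hsq hr hLD).2.2.1
  have hrank : (congruentNumberCurve n).mordellWeilRank = 1 := (hGZK _ hr.le).1.trans hr
  obtain ⟨x, hx⟩ := LevelTwo.exists_not_isOfFinAddOrder_of_one_le_rank (congruentNumberCurve n) hrank.ge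
  have hRnt : ¬ IsOfFinAddOrder R := LevelTwo.not_isOfFinAddOrder_of_generates hx (hR x)
  have hQnt : ¬ IsOfFinAddOrder Q₁ := not_isOfFinAddOrder_half hsq D hRnt hQ₁
  obtain ⟨u, hu, hrel⟩ := two_smul_genusPoint_sub_smul_half_isOfFinAddOrder hsq hrank.le D h35 hL0 hR hQ₁
  rw [← two_dvd_iff_exists_zsmul hu hQnt hrel]
  constructor
  · intro h; exact h _ hLD
  · intro h L hL
    rcases LevelTwo.eq_or_eq_neg_of_isScriptL hL hLD with rfl | rfl
    · exact h
    · exact (dvd_neg).mpr h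

/-- **`4 ∣ 𝓛(n)` ⟺ THE GENUS POINT LIES ON THE DOUBLED LINE `2ℤ·Q₁` modulo torsion** (same data): `4 ∣ L` for every sign
choice `L` of `𝓛(n)` **iff `P(n) − (2m)·Q₁ ∈ A(ℍ′_n)_tor` for some `m`** — the digit of the census B-locus (`Ш ⊇ (ℤ/4)²`).
[cite: TianYuanZhang2017, Thm. 3.5 (p0011 L94–L100)] [cite: Darmon2004, Thm. 3.22] -/
theorem four_dvd_scriptL_iff_genusPoint_mem_twice_line
    (hGZK : rank_eq_analyticRank_of_analyticRank_le_one) (hsq : Squarefree n)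
    (h8 : n % 8 = 5 ∨ n % 8 = 6 ∨ n % 8 = 7) (hr : (congruentNumberCurve n).analyticRank = 1)
    (D : GenusPointData n) (h35 : D.thm35Main) (hLs : D.scriptLSpec)
    {R : (congruentNumberCurve n).toAffine.Point} (hR : ∀ x, ∃ k : ℤ, IsOfFinAddOrder (x - k • R))
    {Q₁ : APoint D.H} (hQ₁ : φH D Q₁ = Point.map (W' := curveA.twoIsogenyCodomain)
      (D.embK n (Nat.mem_divisors_self n hsq.ne_zero)) (ΘE hsq.ne_zero R)) :
    (∀ L : ℤ, IsScriptL n L → (4 : ℤ) ∣ L) ↔ ∃ m : ℤ, IsOfFinAddOrder (D.P n - (2 * m) • Q₁) := by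
  haveI := isElliptic_congruentNumberCurve hsq.ne_zero
  have hn : n ∈ n.divisors := Nat.mem_divisors_self n hsq.ne_zero
  have hn1 : 1 < n := by rcases h8 with h | h | h <;> omega
  have hLD : IsScriptL n (D.scriptL n) := hLs n hn hn1
  have hL0 : D.scriptL n ≠ 0 := (P2.bsdp_two_congruentNumberCurve_iff_of_isScriptL hGZK hsq hr hLD).2.2.1
  have hrank : (congruentNumberCurve n).mordellWeilRank = 1 := (hGZK _ hr.le).1.trans hr
  obtain ⟨x, hx⟩ := LevelTwo.exists_not_isOfFinAddOrder_of_one_le_rank (congruentNumberCurve n) hrank.ge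
  have hRnt : ¬ IsOfFinAddOrder R := LevelTwo.not_isOfFinAddOrder_of_generates hx (hR x)
  have hQnt : ¬ IsOfFinAddOrder Q₁ := not_isOfFinAddOrder_half hsq D hRnt hQ₁
  obtain ⟨u, hu, hrel⟩ := two_smul_genusPoint_sub_smul_half_isOfFinAddOrder hsq hrank.le D h35 hL0 hR hQ₁
  rw [← four_dvd_iff_exists_two_mul_zsmul hu hQnt hrel]
  constructor
  · intro h; exact h _ hLD
  · intro h L hL
    rcases LevelTwo.eq_or_eq_neg_of_isScriptL hL hLD with rfl | rfl
    · exact h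
    · exact (dvd_neg).mpr h

/-- **C⁺ AT `n` ⟺ ON THE LINE AND NOT ON THE DOUBLED LINE** (same data): the conclusion of C⁺ at `n` — `2 ∣ L ∧ 4 ∤ L` for
every sign choice — holds iff `P(n) ∈ ℤ·Q₁ + tors` and `P(n) ∉ 2ℤ·Q₁ + tors`.
[cite: TianYuanZhang2017, Thm. 3.5 (p0011 L94–L100)] [cite: Darmon2004, Thm. 3.22] -/
theorem levelTwo_iff_mem_line_and_not_mem_twice_line
    (hGZK : rank_eq_analyticRank_of_analyticRank_le_one) (hsq : Squarefree n)
    (h8 : n % 8 = 5 ∨ n % 8 = 6 ∨ n % 8 = 7) (hr : (congruentNumberCurve n).analyticRank = 1)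
    (D : GenusPointData n) (h35 : D.thm35Main) (hLs : D.scriptLSpec)
    {R : (congruentNumberCurve n).toAffine.Point} (hR : ∀ x, ∃ k : ℤ, IsOfFinAddOrder (x - k • R))
    {Q₁ : APoint D.H} (hQ₁ : φH D Q₁ = Point.map (W' := curveA.twoIsogenyCodomain)
      (D.embK n (Nat.mem_divisors_self n hsq.ne_zero)) (ΘE hsq.ne_zero R)) :
    (∀ L : ℤ, IsScriptL n L → (2 : ℤ) ∣ L ∧ ¬ (4 : ℤ) ∣ L) ↔
      (∃ m : ℤ, IsOfFinAddOrder (D.P n - m • Q₁)) ∧ ¬ ∃ m : ℤ, IsOfFinAddOrder (D.P n - (2 * m) • Q₁) := by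
  haveI := isElliptic_congruentNumberCurve hsq.ne_zero
  have hn : n ∈ n.divisors := Nat.mem_divisors_self n hsq.ne_zero
  have hn1 : 1 < n := by rcases h8 with h | h | h <;> omega
  have hLD : IsScriptL n (D.scriptL n) := hLs n hn hn1
  rw [← two_dvd_scriptL_iff_genusPoint_mem_line hGZK hsq h8 hr D h35 hLs hR hQ₁,
    ← four_dvd_scriptL_iff_genusPoint_mem_twice_line hGZK hsq h8 hr D h35 hLs hR hQ₁]
  constructor
  · intro h
    refine ⟨fun L hL => (h L hL).1, fun h4 => (h _ hLD).2 (h4 _ hLD)⟩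
  · rintro ⟨h2, h4⟩ L hL
    refine ⟨h2 L hL, fun hL4 => h4 ?_⟩
    intro L' hL'
    rcases LevelTwo.eq_or_eq_neg_of_isScriptL hL' hL with rfl | rfl
    · exact hL4
    · exact (dvd_neg).mpr hL4

/-- **ON THE VISIBLE PART THE LOWER HALF HOLDS** (same data): if the half `Q₁` is NOT `2`-divisible in `A(ℍ′_n)` modulo torsion,
then `2 ∣ L` for every sign choice `L` of `𝓛(n)` (an odd `𝓛(n)` would make `Q₁ ≡ 𝓛⁻¹·2P(n)` divisible — g3's
`half_twoDivisible_of_odd_scriptL`, contraposed).  So on `{[Q₁] ≠ 0}` only the upper half of C⁺ is open.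
[cite: TianYuanZhang2017, Thm. 3.5 (p0011 L94–L100)] [cite: Darmon2004, Thm. 3.22] -/
theorem two_dvd_scriptL_of_half_not_twoDivisible
    (hGZK : rank_eq_analyticRank_of_analyticRank_le_one) (hsq : Squarefree n)
    (hr : (congruentNumberCurve n).analyticRank = 1)
    (D : GenusPointData n) (h35 : D.thm35Main) (hLs : D.scriptLSpec) (hn1 : 1 < n)
    {R : (congruentNumberCurve n).toAffine.Point} (hR : ∀ x, ∃ k : ℤ, IsOfFinAddOrder (x - k • R))
    {Q₁ : APoint D.H} (hQ₁ : φH D Q₁ = Point.map (W' := curveA.twoIsogenyCodomain)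
      (D.embK n (Nat.mem_divisors_self n hsq.ne_zero)) (ΘE hsq.ne_zero R))
    (hQ2 : ¬ ∃ y : APoint D.H, IsOfFinAddOrder (Q₁ - (2 : ℤ) • y)) :
    ∀ L : ℤ, IsScriptL n L → (2 : ℤ) ∣ L := by
  haveI := isElliptic_congruentNumberCurve hsq.ne_zero
  have hn : n ∈ n.divisors := Nat.mem_divisors_self n hsq.ne_zero
  have hLD : IsScriptL n (D.scriptL n) := hLs n hn hn1
  have hrank : (congruentNumberCurve n).mordellWeilRank = 1 := (hGZK _ hr.le).1.trans hr
  have h2 : (2 : ℤ) ∣ D.scriptL n := by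
    by_contra hodd
    have hodd' : Odd (D.scriptL n) := Int.not_even_iff_odd.mp (fun h => hodd (even_iff_two_dvd.mp h))
    exact hQ2 (half_twoDivisible_of_odd_scriptL hsq hrank.le D h35 hodd' hR hQ₁)
  intro L hL
  rcases LevelTwo.eq_or_eq_neg_of_isScriptL hL hLD with rfl | rfl
  · exact h2
  · exact (dvd_neg).mpr h2

end EnSide

end Summit.BirchSwinnertonDyer.PrintCf2.LevelTwoHalves

end
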